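import Literature.RingTheory.CohomologyAnnihilator.NoetherDifferent
import Literature.RingTheory.FittingIdeal.FittingLemma
import Literature.RingTheory.FittingIdeal.Annihilator
import Mathlib.RingTheory.Kaehler.Basic
import Mathlib.LinearAlgebra.Matrix.Determinant.Basic
import Mathlib.RingTheory.Ideal.Operations
import Mathlib.Data.Fintype.Card
import HarnessLib

/-!
# The Kähler different lies in the Noether different (Scheja–Storch; Iyengar–Takahashi 2016, (3.1))

Topic: `Literature/RingTheory/CohomologyAnnihilator`. For a commutative algebra `B` over a commutative
ring `A` write `I = Ker (μ : B ⊗_A B → B)`, so that `Ω_{B/A} = I/I²`. The **Kähler different** of `B/A`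
is `𝔡_K(B/A) := Fitt₀^B(Ω_{B/A})` (Iyengar–Takahashi, *The Jacobian ideal of a commutative ring and
annihilators of cohomology*, arXiv:1610.02599, §3, "Kähler different", after Scheja–Storch, *Lokale
Verzweigungstheorie* (1973) §15, and Wang 1994, Def. 4.2) and the **Noether different** is
`𝔑(B/A) = μ(ann_{B ⊗_A B} I)` (tree: `noetherDifferent`,
`Literature/RingTheory/CohomologyAnnihilator/NoetherDifferent.lean`). Loc. cit. display (3.1):

> If the ideal `Ker(R ⊗_A R → R)` can be generated by `n` elements, then there are inclusions
> `𝔑(R/A)ⁿ ⊆ 𝔡_K(R/A) ⊆ 𝔑(R/A)`. This is proved in, for example, [SchejaStorch73, Satz 15.4];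
> see also [Wang94, Lemma 5.8].

This file PROVES both inclusions — `𝔡_K(B/A) ⊆ 𝔑(B/A)` for `B` essentially of finite type over
`A` (then `I` is finitely generated, Mathlib `KaehlerDifferential.ideal_fg`), and `𝔑(B/A)ⁿ ⊆ 𝔡_K(B/A)`
for `I` generated by `n` elements — phrased with the tree's intrinsic Fitting ideal
`Literature.RingTheory.FittingIdeal.Module.fittingIdeal B (Ω[B⁄A]) 0` (no new definition is
introduced for `𝔡_K`).

Proof (the classical one). Let `z₁, …, zₙ` generate `I`; their classes `x_l = z̄_l` generate
`Ω = I/I²` over `B`, so by Fitting's lemma (`Module.fittingIdeal_eq_relMinorIdeal`) `Fitt₀(Ω)` is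
generated by the determinants of square matrices `P ∈ Mₙ(B)` whose rows are relations
`∑ₗ P_{il} x_l = 0`. Lift `P` to `N = (P_{il} ⊗ 1) ∈ Mₙ(B ⊗_A B)`: each `∑ₗ N_{il} z_l` lies in
`I² = I · (z₁, …, zₙ)`, so `∑ₗ N_{il} z_l = ∑ₗ c_{il} z_l` with `c_{il} ∈ I`. The matrix `N' = N - c`
kills the vector `z`, hence (adjugate) `det N'` kills every `z_l`, i.e. `det N' ∈ ann(I)`; and
`μ(det N') = det (μ N') = det P` because `μ(c_{il}) = 0`. So `det P ∈ μ(ann I) = 𝔑(B/A)`.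

## Content (all proved; no definitions, no named facts)

* `smul_kaehlerDifferential_eq_lmul_smul` — the `B ⊗_A B`-action on `Ω[B⁄A]` factors through `μ`;
  `smul_kaehlerDifferential_eq_zero_of_mem_noetherDifferent` — `𝔑(B/A)` kills `Ω[B⁄A]`;
  `span_range_fromIdeal_eq_top` — generators of `I` give generators of `Ω[B⁄A]` over `B`.
* `det_mem_noetherDifferent_of_relations` — the lifting/adjugate step for one relation matrix.
* `fittingIdeal_kaehlerDifferential_le_noetherDifferent` — **`Fitt₀^B(Ω[B⁄A]) ≤ 𝔑(B/A)`** for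
  `[Algebra.EssFiniteType A B]`.
* `prod_mem_fittingIdeal_kaehlerDifferential`, `noetherDifferent_pow_le_fittingIdeal_kaehlerDifferential`
  — **`𝔑(B/A)ⁿ ≤ Fitt₀^B(Ω[B⁄A])`** for `I` generated by `n` elements; hence
  `noetherDifferent_le_radical_fittingIdeal_kaehlerDifferential` (`𝔑 ≤ √𝔡_K`, Lemma 3.1) and
  `noetherDifferent_eq_bot_of_fittingIdeal_kaehlerDifferential_eq_bot` (`𝔡_K = 0 ⇒ 𝔑 = 0` for
  reduced `B`).

Deliberately NOT here: the Dedekind different (loc. cit. Lemma 3.1); the Jacobian ideal `jac(R)` of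
loc. cit. §3 and Theorems 3.4/3.8 (they need the derived Noether different of §2).

## References

* S. B. Iyengar, R. Takahashi, *The Jacobian ideal of a commutative ring and annihilators of
  cohomology*, J. Algebra (2018); arXiv:1610.02599 — §3, display (3.1), Lemma 3.1.
  [`IyengarTakahashi2016`]
* G. Scheja, U. Storch, *Lokale Verzweigungstheorie*, Schriftenreihe Math. Inst. Univ. Freiburg 5
  (1973/74), Satz 15.4 (cited through the above).
* H.-J. Wang, *On the Fitting ideals in free resolutions*, Michigan Math. J. 41 (1994), Lemma 5.8
  (cited through the above).
-/

noncomputable section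

open scoped TensorProduct
open Literature.RingTheory.FittingIdeal

universe u

namespace Literature.RingTheory.CohomologyAnnihilator

variable {A : Type u} [CommRing A] {B : Type u} [CommRing B] [Algebra A B]

/-- The `B ⊗_A B`-module structure of `Ω[B⁄A] = I/I²` factors through the multiplication
`μ : B ⊗_A B → B`: `s • ω = μ(s) • ω` (because `s - μ(s) ⊗ 1 ∈ I` and `I` kills `I/I²`) —
step of the proof of display (3.1). [cite: IyengarTakahashi2016, §3 (3.1)] -/
theorem smul_kaehlerDifferential_eq_lmul_smul (s : B ⊗[A] B) (ω : Ω[B⁄A]) :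
    s • ω = (Algebra.TensorProduct.lmul' (S := B) A s) • ω := by
  haveI : IsScalarTower B (B ⊗[A] B) Ω[B⁄A] := instIsScalarTowerTensorProductKaehlerDifferential A B
  have hb' : (Algebra.TensorProduct.lmul' (S := B) A s) • ω =
      ((Algebra.TensorProduct.lmul' (S := B) A s) ⊗ₜ[A] (1 : B)) • ω := by
    rw [← IsScalarTower.algebraMap_smul (B ⊗[A] B) (Algebra.TensorProduct.lmul' (S := B) A s) ω,
      Algebra.TensorProduct.algebraMap_apply, Algebra.algebraMap_self_apply]
  have hmem : s - (Algebra.TensorProduct.lmul' (S := B) A s) ⊗ₜ[A] (1 : B) ∈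
      KaehlerDifferential.ideal A B := by
    rw [KaehlerDifferential.ideal, RingHom.mem_ker, map_sub, Algebra.TensorProduct.lmul'_apply_tmul,
      mul_one, sub_self]
  have h0 : (s - (Algebra.TensorProduct.lmul' (S := B) A s) ⊗ₜ[A] (1 : B)) • ω = 0 :=
    Ideal.Cotangent.smul_eq_zero_of_mem hmem ω
  rwa [sub_smul, sub_eq_zero, ← hb'] at h0

/-- **The Noether different kills the Kähler differentials**: `x • ω = 0` for `x ∈ 𝔑(B/A)` and
`ω ∈ Ω[B⁄A]` (`x = μ(t)` with `t ∈ ann(I)`, and `t` kills `I`, hence `I/I²`). This is the reason for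
the first inclusion `𝔑ⁿ ⊆ 𝔡_K` of display (3.1). [cite: IyengarTakahashi2016, §3 (3.1)] -/
theorem smul_kaehlerDifferential_eq_zero_of_mem_noetherDifferent {x : B}
    (hx : x ∈ noetherDifferent A B) (ω : Ω[B⁄A]) : x • ω = 0 := by
  obtain ⟨t, ht, rfl⟩ := mem_noetherDifferent_iff_exists_mem_annihilator.1 hx
  obtain ⟨y, rfl⟩ := KaehlerDifferential.fromIdeal_surjective A B ω
  rw [← smul_kaehlerDifferential_eq_lmul_smul, ← map_smul]
  have hty : t • y = 0 := Subtype.ext (Submodule.mem_annihilator.1 ht y y.2)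
  rw [hty, map_zero]

/-- If `z₁, …, zₙ` generate `I = Ker μ` (as an ideal of `B ⊗_A B`), their classes generate
`Ω[B⁄A] = I/I²` over `B` (the `B ⊗_A B`-action factors through `μ`) — step of the proof of display
(3.1). [cite: IyengarTakahashi2016, §3 (3.1)] -/
theorem span_range_fromIdeal_eq_top {n : ℕ} (z : Fin n → KaehlerDifferential.ideal A B)
    (hz : Ideal.span (Set.range fun l => (z l : B ⊗[A] B)) = KaehlerDifferential.ideal A B) :
    Submodule.span B (Set.range fun l => (KaehlerDifferential.fromIdeal A B (z l) : Ω[B⁄A])) = ⊤ := by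
  classical
  rw [Submodule.eq_top_iff']
  intro ω
  obtain ⟨y, rfl⟩ := KaehlerDifferential.fromIdeal_surjective A B ω
  have hy : (y : B ⊗[A] B) ∈
      Submodule.span (B ⊗[A] B) (Set.range fun l => (z l : B ⊗[A] B)) := by
    rw [← Ideal.span, hz]; exact y.2
  obtain ⟨a, ha⟩ := (Submodule.mem_span_range_iff_exists_fun (B ⊗[A] B)).1 hy
  have hy' : y = ∑ l, a l • z l := by
    apply Subtype.ext
    rw [AddSubmonoidClass.coe_finsetSum, ← ha]
    refine Finset.sum_congr rfl fun l _ => ?_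
    rw [Submodule.coe_smul]
  rw [hy', map_sum]
  refine Submodule.sum_mem _ fun l _ => ?_
  rw [map_smul, smul_kaehlerDifferential_eq_lmul_smul]
  exact Submodule.smul_mem _ _ (Submodule.subset_span ⟨l, rfl⟩)

/-- **The lifting/adjugate step** (proof of `𝔡_K ⊆ 𝔑`, Scheja–Storch Satz 15.4): if `z₁, …, zₙ`
generate `I = Ker μ` and the rows of `P ∈ Mₙ(B)` are relations among the classes `z̄_l ∈ Ω[B⁄A]`,
then `det P ∈ 𝔑(B/A)`. [cite: IyengarTakahashi2016, §3 (3.1)] -/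
theorem det_mem_noetherDifferent_of_relations {n : ℕ} (z : Fin n → KaehlerDifferential.ideal A B)
    (hz : Ideal.span (Set.range fun l => (z l : B ⊗[A] B)) = KaehlerDifferential.ideal A B)
    (P : Matrix (Fin n) (Fin n) B)
    (hP : ∀ i, ∑ l, P i l • (KaehlerDifferential.fromIdeal A B (z l) : Ω[B⁄A]) = 0) :
    P.det ∈ noetherDifferent A B := by
  classical
  haveI : IsScalarTower B (B ⊗[A] B) Ω[B⁄A] := instIsScalarTowerTensorProductKaehlerDifferential A B
  -- the lifted matrix `N = (P i l ⊗ 1)`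
  let N : Matrix (Fin n) (Fin n) (B ⊗[A] B) := Matrix.of fun i l => P i l ⊗ₜ[A] (1 : B)
  -- its rows are relations modulo `I²`
  have hN : ∀ i, ∑ l, N i l * (z l : B ⊗[A] B) ∈ KaehlerDifferential.ideal A B ^ 2 := by
    intro i
    have h1 : (KaehlerDifferential.fromIdeal A B (∑ l, N i l • z l) : Ω[B⁄A]) = 0 := by
      rw [map_sum, ← hP i]
      refine Finset.sum_congr rfl fun l _ => ?_
      rw [map_smul]
      simp only [N, Matrix.of_apply]
      rw [← IsScalarTower.algebraMap_smul (B ⊗[A] B) (P i l), Algebra.TensorProduct.algebraMap_apply,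
        Algebra.algebraMap_self_apply]
    have h2 : ((∑ l, N i l • z l : KaehlerDifferential.ideal A B) : B ⊗[A] B) ∈
        KaehlerDifferential.ideal A B ^ 2 :=
      (Ideal.toCotangent_eq_zero _ _).1 h1
    have h3 : ((∑ l, N i l • z l : KaehlerDifferential.ideal A B) : B ⊗[A] B) =
        ∑ l, N i l * (z l : B ⊗[A] B) := by
      rw [AddSubmonoidClass.coe_finsetSum]
      refine Finset.sum_congr rfl fun l _ => ?_
      rw [Submodule.coe_smul, smul_eq_mul]
    rwa [h3] at h2
  -- correct each row by an `I`-valued row so that it becomes an honest relation among the `z_l`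
  have hrow : ∀ i, ∃ c : Fin n → B ⊗[A] B, (∀ l, c l ∈ KaehlerDifferential.ideal A B) ∧
      ∑ l, c l * (z l : B ⊗[A] B) = ∑ l, N i l * (z l : B ⊗[A] B) := by
    intro i
    have hle : KaehlerDifferential.ideal A B ^ 2 ≤
        Ideal.span (Set.range fun l => (z l : B ⊗[A] B)) •
          Submodule.span (B ⊗[A] B) (Set.range fun l => (z l : B ⊗[A] B)) := by
      change _ ≤ Ideal.span _ • Ideal.span _
      rw [hz, pow_two, Ideal.smul_eq_mul]
    have hmem := hle (hN i)
    obtain ⟨a, ha, hsum⟩ := (Submodule.mem_ideal_smul_span_iff_exists_sum _ _ _).1 hmem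
    refine ⟨fun l => a l, fun l => hz ▸ ha l, ?_⟩
    rw [← hsum, Finsupp.sum_fintype _ _ (fun l => by rw [zero_smul])]
    simp only [smul_eq_mul]
  choose c hcI hcsum using hrow
  let N' : Matrix (Fin n) (Fin n) (B ⊗[A] B) := Matrix.of fun i l => N i l - c i l
  have hN' : ∀ i, ∑ l, N' i l • (z l : B ⊗[A] B) = 0 := by
    intro i
    simp only [N', Matrix.of_apply, smul_eq_mul, sub_mul, Finset.sum_sub_distrib, hcsum i, sub_self]
  -- adjugate: `det N'` kills every generator, hence `I`
  have hkill : ∀ l, N'.det * (z l : B ⊗[A] B) = 0 := fun l => by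
    have h := Matrix.det_smul_eq_zero_of_sum_smul_eq_zero N' (fun l => (z l : B ⊗[A] B)) hN' l
    rwa [smul_eq_mul] at h
  have hann : N'.det ∈ (KaehlerDifferential.ideal A B).annihilator := by
    rw [← hz, Submodule.mem_annihilator_span]
    rintro ⟨w, l, rfl⟩
    rw [smul_eq_mul]
    exact hkill l
  -- `μ(det N') = det P`
  have hμN' : (Algebra.TensorProduct.lmul' (S := B) A).mapMatrix N' = P := by
    ext i l
    have hc0 : Algebra.TensorProduct.lmul' (S := B) A (c i l) = 0 := (RingHom.mem_ker).1 (hcI i l)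
    simp only [AlgHom.mapMatrix_apply, Matrix.map_apply, N', N, Matrix.of_apply, map_sub, hc0,
      sub_zero, Algebra.TensorProduct.lmul'_apply_tmul, mul_one]
  have hdet : Algebra.TensorProduct.lmul' (S := B) A N'.det = P.det := by
    rw [AlgHom.map_det, hμN']
  rw [← hdet]
  exact mem_noetherDifferent_iff_exists_mem_annihilator.2 ⟨N'.det, hann, rfl⟩

/-- **The Kähler different lies in the Noether different**, `𝔡_K(B/A) = Fitt₀^B(Ω_{B/A}) ⊆ 𝔑(B/A)`,
for `B` essentially of finite type over `A` (so that `I = Ker(B ⊗_A B → B)` is finitely generated):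
Iyengar–Takahashi 2016, display (3.1) `𝔑ⁿ ⊆ 𝔡_K ⊆ 𝔑` ("proved in [SchejaStorch73, Satz 15.4]; see
also [Wang94, Lemma 5.8]"); we prove the second inclusion. [cite: IyengarTakahashi2016, §3 (3.1)] -/
theorem fittingIdeal_kaehlerDifferential_le_noetherDifferent [Algebra.EssFiniteType A B] :
    Module.fittingIdeal B (Ω[B⁄A]) 0 ≤ noetherDifferent A B := by
  classical
  obtain ⟨n, z₀, hz₀⟩ :=
    Submodule.fg_iff_exists_fin_generating_family.1 (KaehlerDifferential.ideal_fg A B)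
  have hzI : ∀ l, z₀ l ∈ KaehlerDifferential.ideal A B := fun l =>
    hz₀ ▸ Submodule.subset_span ⟨l, rfl⟩
  let z : Fin n → KaehlerDifferential.ideal A B := fun l => ⟨z₀ l, hzI l⟩
  have hz : Ideal.span (Set.range fun l => (z l : B ⊗[A] B)) = KaehlerDifferential.ideal A B := hz₀
  -- the classes of the `z_l` generate `Ω[B⁄A]` over `B`
  let x : Fin n → Ω[B⁄A] := fun l => KaehlerDifferential.fromIdeal A B (z l)
  have hx : Submodule.span B (Set.range x) = ⊤ := span_range_fromIdeal_eq_top z hz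
  rw [Module.fittingIdeal_eq_relMinorIdeal x hx 0, Nat.sub_zero, Module.relMinorIdeal_le_iff]
  intro ρ σ hρ
  by_cases hσ : Function.Injective σ
  · -- `σ` is a permutation of the generators: reindex and apply the lifting step to `z ∘ σ`
    have hbij : Function.Bijective σ := Finite.injective_iff_bijective.1 hσ
    let e : Fin n ≃ Fin n := Equiv.ofBijective σ hbij
    refine det_mem_noetherDifferent_of_relations (z ∘ σ) ?_ (Matrix.of fun i i' => ρ i (σ i')) ?_
    · have hr : (Set.range fun l => ((z ∘ σ) l : B ⊗[A] B)) =
          Set.range fun l => (z l : B ⊗[A] B) :=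
        hbij.2.range_comp fun l => (z l : B ⊗[A] B)
      rw [hr]
      exact hz
    · intro i
      rw [← hρ i]
      exact e.sum_comp (fun l => ρ i l • x l)
  · -- two equal columns
    obtain ⟨a, b, hab, hne⟩ := Function.not_injective_iff.1 hσ
    rw [Matrix.det_zero_of_column_eq hne (fun k => by simp only [Matrix.of_apply, hab])]
    exact Submodule.zero_mem _

/-- **First inclusion of display (3.1), elementwise**: if `I = Ker(B ⊗_A B → B)` is generated by
`n` elements `z₁, …, zₙ`, then any product of `n` elements of `𝔑(B/A)` lies in
`𝔡_K(B/A) = Fitt₀^B(Ω_{B/A})` — the diagonal matrix `diag(x₁, …, xₙ)` is a relation matrix among the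
generators `z̄_l` of `Ω` because `𝔑` kills `Ω`. [cite: IyengarTakahashi2016, §3 (3.1)] -/
theorem prod_mem_fittingIdeal_kaehlerDifferential {n : ℕ} (z : Fin n → KaehlerDifferential.ideal A B)
    (hz : Ideal.span (Set.range fun l => (z l : B ⊗[A] B)) = KaehlerDifferential.ideal A B)
    (x : Fin n → B) (hx : ∀ i, x i ∈ noetherDifferent A B) :
    ∏ i, x i ∈ Module.fittingIdeal B (Ω[B⁄A]) 0 := by
  classical
  have hgen := span_range_fromIdeal_eq_top z hz
  rw [Module.fittingIdeal_eq_relMinorIdeal _ hgen 0, Nat.sub_zero, ← Matrix.det_diagonal]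
  have h := Module.det_mem_relMinorIdeal (R := B)
    (fun l => (KaehlerDifferential.fromIdeal A B (z l) : Ω[B⁄A])) (Matrix.diagonal x) (fun i => ?_) id
  · convert h using 2
    ext i j
    rfl
  · rw [Finset.sum_eq_single i (fun l _ hl => by rw [Matrix.diagonal_apply_ne _ (Ne.symm hl), zero_smul])
      (fun hi => absurd (Finset.mem_univ i) hi), Matrix.diagonal_apply_eq]
    exact smul_kaehlerDifferential_eq_zero_of_mem_noetherDifferent (hx i) _

/-- **First inclusion of display (3.1)**: if `I = Ker(B ⊗_A B → B)` is generated by `n` elements,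
then `𝔑(B/A)ⁿ ⊆ 𝔡_K(B/A) = Fitt₀^B(Ω_{B/A})`; together with
`fittingIdeal_kaehlerDifferential_le_noetherDifferent` the two differents agree up to radical
(loc. cit. Lemma 3.1). [cite: IyengarTakahashi2016, §3 (3.1)] -/
theorem noetherDifferent_pow_le_fittingIdeal_kaehlerDifferential {n : ℕ}
    (z : Fin n → KaehlerDifferential.ideal A B)
    (hz : Ideal.span (Set.range fun l => (z l : B ⊗[A] B)) = KaehlerDifferential.ideal A B) :
    noetherDifferent A B ^ n ≤ Module.fittingIdeal B (Ω[B⁄A]) 0 := by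
  classical
  rw [Submodule.pow_eq_span_pow_set, Submodule.span_le]
  intro y hy
  obtain ⟨f, rfl⟩ := Set.mem_pow.1 hy
  rw [List.prod_ofFn]
  exact prod_mem_fittingIdeal_kaehlerDifferential z hz (fun i => (f i : B)) fun i => (f i).2

/-- **The two differents agree up to radical** (Iyengar–Takahashi 2016 Lemma 3.1, the part
`𝔑 ⊆ √𝔡_K`): for `B` essentially of finite type over `A`, `𝔑(B/A) ≤ √Fitt₀^B(Ω_{B/A})` (from
`𝔑ⁿ ⊆ 𝔡_K`, `n` = a number of generators of `I`). [cite: IyengarTakahashi2016, Lemma 3.1] -/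
theorem noetherDifferent_le_radical_fittingIdeal_kaehlerDifferential [Algebra.EssFiniteType A B] :
    noetherDifferent A B ≤ (Module.fittingIdeal B (Ω[B⁄A]) 0).radical := by
  obtain ⟨n, z₀, hz₀⟩ :=
    Submodule.fg_iff_exists_fin_generating_family.1 (KaehlerDifferential.ideal_fg A B)
  have hzI : ∀ l, z₀ l ∈ KaehlerDifferential.ideal A B := fun l =>
    hz₀ ▸ Submodule.subset_span ⟨l, rfl⟩
  intro x hx
  exact ⟨n, noetherDifferent_pow_le_fittingIdeal_kaehlerDifferential (fun l => ⟨z₀ l, hzI l⟩) hz₀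
    (Ideal.pow_mem_pow hx n)⟩

/-- **Where the Kähler different vanishes, so does the Noether different** (consequence of Lemma 3.1
for a reduced `B` essentially of finite type over `A`): `Fitt₀^B(Ω_{B/A}) = 0 ⇒ 𝔑(B/A) = 0`. E.g.
when `Frac B` is inseparable over `Frac A` for a domain `B` finite over `A`, every Noether-different
floor over `A` is as void as the Kähler-different one. [cite: IyengarTakahashi2016, Lemma 3.1] -/
theorem noetherDifferent_eq_bot_of_fittingIdeal_kaehlerDifferential_eq_bot [Algebra.EssFiniteType A B]
    [IsReduced B] (h : Module.fittingIdeal B (Ω[B⁄A]) 0 = ⊥) : noetherDifferent A B = ⊥ := by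
  rw [← le_bot_iff]
  intro x hx
  have hrad := noetherDifferent_le_radical_fittingIdeal_kaehlerDifferential hx
  rw [h] at hrad
  have hnil : x ∈ nilradical B := hrad
  rwa [nilradical_eq_zero, Ideal.zero_eq_bot] at hnil

end Literature.RingTheory.CohomologyAnnihilator

end
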